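import Mathlib
import Summits.KontsevichZagierPeriods.KontsevichZagierPeriods.Theorems.InverseLandauTateFamilyKernelStubLinExact
import Summits.KontsevichZagierPeriods.KontsevichZagierPeriods.Theorems.InverseLandauTateFamilyKernelStubGpPolyIntegral

/-!
# Crux `TateFamilyKernel` (stmt-KontsevichZagierPeriods-9130), line `Sketch`: `stub_gvPrimitive`

Step GV3a of the linear-slope graph-pencil class (`Q = 1 − ϖ·(u(z₂) + (γ + δz₂)z₁)`,
`u ∈ ℚ[s]`, `γ, δ ∈ ℚ`, `δ ≠ 0`, numerator `P ∈ ℚ[z₁, z₂]`; regime (E1) of the elementary sector)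
of the lead's skeleton of the crux
`Summit.KontsevichZagierPeriods.KontsevichZagierPeriods.Theses.InverseLandau.TateFamilyKernel`:
**the single-branch primitive is rational plus ONE logarithm.** With `v(σ) = γ + δσ` the
integrand `f(y, σ) = P((y − u(σ))/v(σ), σ)/v(σ)` has, wherever `v ≠ 0`, a primitive in `σ` of the
shape

  `F(y, σ) = Rn(y, σ)/v(σ)^k + a(y)·log |v(σ)|`,  `Rn ∈ ℚ[y, σ]`, `k ∈ ℕ`, `a ∈ ℚ[y]`,

and hence `∫_{σ ∈ (s,1)} f(y, σ) dσ = F(y, 1) − F(y, s)` whenever `s ≤ 1` and `v ≠ 0` on `[s, 1]`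
(variables `X 0 = y`, `X 1 = σ`). Elementary proof, in three steps:

* `GvPrimitive.exists_rep` — since `σ = (v − γ)/δ`, the integrand is `M(y, v(σ))/v(σ)^m` for a
  polynomial `M ∈ ℚ[X 0, X 1]` and an `m ∈ ℕ` (induction on `P`: `z₁ ↦ (X 0 − u((X 1 − γ)/δ))`
  costs one power of `v`, `z₂ ↦ (X 1 − γ)/δ` costs none);
* `GvPrimitive.hasPrim_aeval_div_pow` — every `M(y, v)/v^m` has a primitive of the shape above
  (linearity in `M`, so it suffices to treat `c·y^p·v^j/v^m`, i.e. the three cases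
  `v^n ↦ v^{n+1}/((n+1)δ)`, `1/v ↦ log|v|/δ`, `1/v^{n+2} ↦ −1/((n+1)δ v^{n+1})`; two shapes are
  added over the common denominator `v^{k₁+k₂}`);
* the fundamental theorem of calculus on `[s, 1]` (`GvPrimitive.integral_Ioo_eq_sub`), the
  integrand being continuous there because `v ≠ 0` on `[s, 1]`.

The restriction `s ≤ 1` is necessary (for `s > 1` the set integral is `0`); the value `k` and the
polynomials `Rn, a` depend on `P, u, γ, δ` only. References: Kontsevich–Zagier 2001, §1.2 (an
elementary step of one test class of the period conjecture). Mathlib, the landed linear-class file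
`…StubLinExact` (`LinExact.hasDerivAt_aeval_snd`: `d/dσ R(y, σ) = (∂₁R)(y, σ)`) and the landed
graph-pencil file `…StubGpPolyIntegral` (`GpPolyIntegral.continuous_aeval_snd`) only; no named
fact, no new definition (the shape is spelled out as an `∃` in each helper). Helpers live in the
sub-namespace `GvPrimitive`.
-/

noncomputable section

open MeasureTheory Set MvPolynomial
open Literature.NumberTheory.Transcendental
open scoped Topology

namespace Summit.KontsevichZagierPeriods.InverseLandau.TateFamilyKernel.Descent

namespace GvPrimitive

/-! ### One-variable calculus of the linear form `v(σ) = γ + δσ` -/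

/-- `d/dσ (γ + δσ) = δ`. [folklore] -/
theorem hasDerivAt_lin (γ δ : ℚ) (σ : ℝ) :
    HasDerivAt (fun σ' : ℝ => (γ : ℝ) + δ * σ') (δ : ℝ) σ := by
  simpa using ((hasDerivAt_id σ).const_mul (δ : ℝ)).const_add (γ : ℝ)

/-- The real evaluation of `V = γ + δ·X 1` at `(y, σ)` is `v(σ) = γ + δσ`. [folklore] -/
theorem aeval_lin (γ δ : ℚ) (y σ : ℝ) :
    aeval ![y, σ] (C γ + C δ * X 1 : MvPolynomial (Fin 2) ℚ) = (γ : ℝ) + δ * σ := by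
  simp [eq_ratCast]

/-- Positive powers: `d/dσ v^{n+1}/((n+1)δ) = v^n` (`δ ≠ 0`). [folklore] -/
theorem hasDerivAt_pow_succ (γ δ : ℚ) (hδ : δ ≠ 0) (n : ℕ) (σ : ℝ) :
    HasDerivAt (fun σ' : ℝ => ((γ : ℝ) + δ * σ') ^ (n + 1) / ((n + 1) * δ))
      (((γ : ℝ) + δ * σ) ^ n) σ := by
  have hδ' : (δ : ℝ) ≠ 0 := by exact_mod_cast hδ
  have hn : ((n : ℝ) + 1) ≠ 0 := Nat.cast_add_one_ne_zero n
  refine (((hasDerivAt_lin γ δ σ).fun_pow (n + 1)).div_const (((n : ℝ) + 1) * δ)).congr_deriv ?_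
  rw [Nat.add_sub_cancel]
  push_cast
  field_simp

/-- Negative powers below `−1`: `d/dσ (−1/((n+1)δ))/v^{n+1} = 1/v^{n+2}` at every `σ` with
`v(σ) ≠ 0` (`δ ≠ 0`). [folklore] -/
theorem hasDerivAt_inv_pow (γ δ : ℚ) (hδ : δ ≠ 0) (n : ℕ) (σ : ℝ) (hv : (γ : ℝ) + δ * σ ≠ 0) :
    HasDerivAt (fun σ' : ℝ => (-1 / ((n + 1) * δ)) / ((γ : ℝ) + δ * σ') ^ (n + 1))
      (1 / ((γ : ℝ) + δ * σ) ^ (n + 2)) σ := by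
  have hδ' : (δ : ℝ) ≠ 0 := by exact_mod_cast hδ
  have hn : ((n : ℝ) + 1) ≠ 0 := Nat.cast_add_one_ne_zero n
  have h := ((((hasDerivAt_lin γ δ σ).fun_pow (n + 1)).fun_inv (pow_ne_zero _ hv)).const_mul
    (-1 / (((n : ℝ) + 1) * δ)))
  have hfun : (fun σ' : ℝ => (-1 / (((n : ℝ) + 1) * δ)) / ((γ : ℝ) + δ * σ') ^ (n + 1)) =
      fun σ' : ℝ => (-1 / (((n : ℝ) + 1) * δ)) * (((γ : ℝ) + δ * σ') ^ (n + 1))⁻¹ := by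
    funext σ'
    rw [div_eq_mul_inv]
  rw [hfun]
  refine h.congr_deriv ?_
  rw [Nat.add_sub_cancel]
  push_cast
  field_simp
  ring

/-- The residual power: `d/dσ log|v|/δ = 1/v` at every `σ` with `v(σ) ≠ 0` (`δ ≠ 0`; Mathlib's
`Real.log` is even, `log |x| = log x`). [folklore] -/
theorem hasDerivAt_log (γ δ : ℚ) (hδ : δ ≠ 0) (σ : ℝ) (hv : (γ : ℝ) + δ * σ ≠ 0) :
    HasDerivAt (fun σ' : ℝ => 1 / (δ : ℝ) * Real.log |(γ : ℝ) + δ * σ'|)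
      (1 / ((γ : ℝ) + δ * σ)) σ := by
  have hδ' : (δ : ℝ) ≠ 0 := by exact_mod_cast hδ
  simp_rw [Real.log_abs]
  refine (((hasDerivAt_lin γ δ σ).log hv).const_mul (1 / (δ : ℝ))).congr_deriv ?_
  field_simp

/-! ### Primitives of the shape `Rn(y,σ)/v(σ)^k + a(y) log|v(σ)|` -/

/-- The shape of primitive is insensitive to changing the integrand where `v ≠ 0`. [folklore] -/
theorem hasPrim_congr (γ δ : ℚ) {g₁ g₂ : ℝ → ℝ → ℝ}
    (hg : ∀ y σ : ℝ, (γ : ℝ) + δ * σ ≠ 0 → g₁ y σ = g₂ y σ)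
    (h : ∃ (Rn : MvPolynomial (Fin 2) ℚ) (k : ℕ) (a : Polynomial ℚ), ∀ y σ : ℝ,
      (γ : ℝ) + δ * σ ≠ 0 → HasDerivAt (fun σ' : ℝ => aeval ![y, σ'] Rn / ((γ : ℝ) + δ * σ') ^ k +
        Polynomial.aeval y a * Real.log |(γ : ℝ) + δ * σ'|) (g₁ y σ) σ) :
    ∃ (Rn : MvPolynomial (Fin 2) ℚ) (k : ℕ) (a : Polynomial ℚ), ∀ y σ : ℝ,
      (γ : ℝ) + δ * σ ≠ 0 → HasDerivAt (fun σ' : ℝ => aeval ![y, σ'] Rn / ((γ : ℝ) + δ * σ') ^ k +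
        Polynomial.aeval y a * Real.log |(γ : ℝ) + δ * σ'|) (g₂ y σ) σ := by
  obtain ⟨Rn, k, a, h⟩ := h
  exact ⟨Rn, k, a, fun y σ hv => (h y σ hv).congr_deriv (hg y σ hv)⟩

/-- **Sum of two shapes**, over the common denominator `v^{k₁+k₂}`:
`Rn = Rn₁·V^{k₂} + Rn₂·V^{k₁}`, `a = a₁ + a₂` (the two functions agree near every `σ` with
`v(σ) ≠ 0`, an open condition). [folklore] -/
theorem hasPrim_add (γ δ : ℚ) {g₁ g₂ : ℝ → ℝ → ℝ}
    (h₁ : ∃ (Rn : MvPolynomial (Fin 2) ℚ) (k : ℕ) (a : Polynomial ℚ), ∀ y σ : ℝ,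
      (γ : ℝ) + δ * σ ≠ 0 → HasDerivAt (fun σ' : ℝ => aeval ![y, σ'] Rn / ((γ : ℝ) + δ * σ') ^ k +
        Polynomial.aeval y a * Real.log |(γ : ℝ) + δ * σ'|) (g₁ y σ) σ)
    (h₂ : ∃ (Rn : MvPolynomial (Fin 2) ℚ) (k : ℕ) (a : Polynomial ℚ), ∀ y σ : ℝ,
      (γ : ℝ) + δ * σ ≠ 0 → HasDerivAt (fun σ' : ℝ => aeval ![y, σ'] Rn / ((γ : ℝ) + δ * σ') ^ k +
        Polynomial.aeval y a * Real.log |(γ : ℝ) + δ * σ'|) (g₂ y σ) σ) :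
    ∃ (Rn : MvPolynomial (Fin 2) ℚ) (k : ℕ) (a : Polynomial ℚ), ∀ y σ : ℝ,
      (γ : ℝ) + δ * σ ≠ 0 → HasDerivAt (fun σ' : ℝ => aeval ![y, σ'] Rn / ((γ : ℝ) + δ * σ') ^ k +
        Polynomial.aeval y a * Real.log |(γ : ℝ) + δ * σ'|) (g₁ y σ + g₂ y σ) σ := by
  obtain ⟨R₁, k₁, a₁, h₁⟩ := h₁
  obtain ⟨R₂, k₂, a₂, h₂⟩ := h₂
  refine ⟨R₁ * (C γ + C δ * X 1) ^ k₂ + R₂ * (C γ + C δ * X 1) ^ k₁, k₁ + k₂, a₁ + a₂,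
    fun y σ hv => ?_⟩
  have hev : ∀ᶠ σ' in 𝓝 σ, (γ : ℝ) + δ * σ' ≠ 0 :=
    (continuous_const.add (continuous_const.mul continuous_id)).continuousAt.eventually_ne hv
  refine ((h₁ y σ hv).add (h₂ y σ hv)).congr_of_eventuallyEq (hev.mono fun σ' hσ' => ?_)
  simp only [Pi.add_apply]
  rw [map_add, map_mul, map_mul, map_pow, map_pow, aeval_lin, map_add, pow_add]
  field_simp
  ring

/-- **Multiplying a shape by a polynomial in `y`**: `Rn ↦ q(X 0)·Rn`, `a ↦ q·a`. [folklore] -/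
theorem hasPrim_mul (γ δ : ℚ) (q : Polynomial ℚ) {g : ℝ → ℝ → ℝ}
    (h : ∃ (Rn : MvPolynomial (Fin 2) ℚ) (k : ℕ) (a : Polynomial ℚ), ∀ y σ : ℝ,
      (γ : ℝ) + δ * σ ≠ 0 → HasDerivAt (fun σ' : ℝ => aeval ![y, σ'] Rn / ((γ : ℝ) + δ * σ') ^ k +
        Polynomial.aeval y a * Real.log |(γ : ℝ) + δ * σ'|) (g y σ) σ) :
    ∃ (Rn : MvPolynomial (Fin 2) ℚ) (k : ℕ) (a : Polynomial ℚ), ∀ y σ : ℝ,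
      (γ : ℝ) + δ * σ ≠ 0 → HasDerivAt (fun σ' : ℝ => aeval ![y, σ'] Rn / ((γ : ℝ) + δ * σ') ^ k +
        Polynomial.aeval y a * Real.log |(γ : ℝ) + δ * σ'|) (Polynomial.aeval y q * g y σ) σ := by
  obtain ⟨Rn, k, a, h⟩ := h
  refine ⟨Polynomial.aeval (X 0 : MvPolynomial (Fin 2) ℚ) q * Rn, k, q * a, fun y σ hv => ?_⟩
  have hfun : (fun σ' : ℝ =>
      aeval ![y, σ'] (Polynomial.aeval (X 0 : MvPolynomial (Fin 2) ℚ) q * Rn) /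
        ((γ : ℝ) + δ * σ') ^ k + Polynomial.aeval y (q * a) * Real.log |(γ : ℝ) + δ * σ'|) =
      fun σ' : ℝ => Polynomial.aeval y q * (aeval ![y, σ'] Rn / ((γ : ℝ) + δ * σ') ^ k +
        Polynomial.aeval y a * Real.log |(γ : ℝ) + δ * σ'|) := by
    funext σ'
    have hq' : aeval ![y, σ'] (Polynomial.aeval (X 0 : MvPolynomial (Fin 2) ℚ) q) =
        Polynomial.aeval y q := by
      rw [← Polynomial.aeval_algHom_apply, aeval_X, Matrix.cons_val_zero]
    rw [map_mul, map_mul, hq']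
    ring
  rw [hfun]
  exact (h y σ hv).const_mul _

/-- Shape of `v^n`: `Rn = V^{n+1}/((n+1)δ)`, `k = 0`, `a = 0`. [folklore] -/
theorem hasPrim_pow (γ δ : ℚ) (hδ : δ ≠ 0) (n : ℕ) :
    ∃ (Rn : MvPolynomial (Fin 2) ℚ) (k : ℕ) (a : Polynomial ℚ), ∀ y σ : ℝ,
      (γ : ℝ) + δ * σ ≠ 0 → HasDerivAt (fun σ' : ℝ => aeval ![y, σ'] Rn / ((γ : ℝ) + δ * σ') ^ k +
        Polynomial.aeval y a * Real.log |(γ : ℝ) + δ * σ'|) (((γ : ℝ) + δ * σ) ^ n) σ := by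
  refine ⟨C (1 / ((n + 1) * δ)) * (C γ + C δ * X 1) ^ (n + 1), 0, 0, fun y σ _ => ?_⟩
  have hfun : (fun σ' : ℝ => aeval ![y, σ']
        (C (1 / ((n + 1) * δ)) * (C γ + C δ * X 1) ^ (n + 1) : MvPolynomial (Fin 2) ℚ) /
          ((γ : ℝ) + δ * σ') ^ 0 +
        Polynomial.aeval y (0 : Polynomial ℚ) * Real.log |(γ : ℝ) + δ * σ'|) =
      fun σ' : ℝ => ((γ : ℝ) + δ * σ') ^ (n + 1) / ((n + 1) * δ) := by
    funext σ'
    rw [pow_zero, div_one, map_zero, zero_mul, add_zero, map_mul, map_pow, aeval_lin, aeval_C,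
      eq_ratCast]
    push_cast
    ring
  rw [hfun]
  exact hasDerivAt_pow_succ γ δ hδ n σ

/-- Shape of `1/v`: `Rn = 0`, `k = 0`, `a = 1/δ` — the logarithm. [folklore] -/
theorem hasPrim_inv (γ δ : ℚ) (hδ : δ ≠ 0) :
    ∃ (Rn : MvPolynomial (Fin 2) ℚ) (k : ℕ) (a : Polynomial ℚ), ∀ y σ : ℝ,
      (γ : ℝ) + δ * σ ≠ 0 → HasDerivAt (fun σ' : ℝ => aeval ![y, σ'] Rn / ((γ : ℝ) + δ * σ') ^ k +
        Polynomial.aeval y a * Real.log |(γ : ℝ) + δ * σ'|) (1 / ((γ : ℝ) + δ * σ)) σ := by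
  refine ⟨0, 0, Polynomial.C (1 / δ), fun y σ hv => ?_⟩
  have hfun : (fun σ' : ℝ => aeval ![y, σ'] (0 : MvPolynomial (Fin 2) ℚ) /
          ((γ : ℝ) + δ * σ') ^ 0 +
        Polynomial.aeval y (Polynomial.C (1 / δ)) * Real.log |(γ : ℝ) + δ * σ'|) =
      fun σ' : ℝ => 1 / (δ : ℝ) * Real.log |(γ : ℝ) + δ * σ'| := by
    funext σ'
    rw [map_zero, zero_div, zero_add, Polynomial.aeval_C, eq_ratCast]
    push_cast
    ring
  rw [hfun]
  exact hasDerivAt_log γ δ hδ σ hv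

/-- Shape of `1/v^{n+2}`: `Rn = −1/((n+1)δ)`, `k = n + 1`, `a = 0`. [folklore] -/
theorem hasPrim_inv_pow (γ δ : ℚ) (hδ : δ ≠ 0) (n : ℕ) :
    ∃ (Rn : MvPolynomial (Fin 2) ℚ) (k : ℕ) (a : Polynomial ℚ), ∀ y σ : ℝ,
      (γ : ℝ) + δ * σ ≠ 0 → HasDerivAt (fun σ' : ℝ => aeval ![y, σ'] Rn / ((γ : ℝ) + δ * σ') ^ k +
        Polynomial.aeval y a * Real.log |(γ : ℝ) + δ * σ'|)
        (1 / ((γ : ℝ) + δ * σ) ^ (n + 2)) σ := by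
  refine ⟨C (-1 / ((n + 1) * δ)), n + 1, 0, fun y σ hv => ?_⟩
  have hfun : (fun σ' : ℝ => aeval ![y, σ'] (C (-1 / ((n + 1) * δ)) : MvPolynomial (Fin 2) ℚ) /
          ((γ : ℝ) + δ * σ') ^ (n + 1) +
        Polynomial.aeval y (0 : Polynomial ℚ) * Real.log |(γ : ℝ) + δ * σ'|) =
      fun σ' : ℝ => (-1 / ((n + 1) * δ)) / ((γ : ℝ) + δ * σ') ^ (n + 1) := by
    funext σ'
    rw [map_zero, zero_mul, add_zero, aeval_C, eq_ratCast]
    push_cast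
    ring
  rw [hfun]
  exact hasDerivAt_inv_pow γ δ hδ n σ hv

/-- Shape of `v^j/v^m` for all `j, m ∈ ℕ`: the three cases `m ≤ j`, `m = j + 1`, `m ≥ j + 2`.
[folklore] -/
theorem hasPrim_pow_div_pow (γ δ : ℚ) (hδ : δ ≠ 0) (j m : ℕ) :
    ∃ (Rn : MvPolynomial (Fin 2) ℚ) (k : ℕ) (a : Polynomial ℚ), ∀ y σ : ℝ,
      (γ : ℝ) + δ * σ ≠ 0 → HasDerivAt (fun σ' : ℝ => aeval ![y, σ'] Rn / ((γ : ℝ) + δ * σ') ^ k +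
        Polynomial.aeval y a * Real.log |(γ : ℝ) + δ * σ'|)
        (((γ : ℝ) + δ * σ) ^ j / ((γ : ℝ) + δ * σ) ^ m) σ := by
  rcases Nat.lt_or_ge j m with hjm | hmj
  · obtain ⟨K, rfl⟩ := Nat.exists_eq_add_of_lt hjm
    cases K with
    | zero =>
      refine hasPrim_congr γ δ (g₁ := fun _ σ => 1 / ((γ : ℝ) + δ * σ)) (fun y σ hv => ?_)
        (hasPrim_inv γ δ hδ)
      rw [div_eq_div_iff hv (pow_ne_zero _ hv)]
      ring
    | succ n =>
      refine hasPrim_congr γ δ (g₁ := fun _ σ => 1 / ((γ : ℝ) + δ * σ) ^ (n + 2))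
        (fun y σ hv => ?_) (hasPrim_inv_pow γ δ hδ n)
      rw [div_eq_div_iff (pow_ne_zero _ hv) (pow_ne_zero _ hv)]
      ring
  · obtain ⟨n, rfl⟩ := Nat.exists_eq_add_of_le hmj
    refine hasPrim_congr γ δ (g₁ := fun _ σ => ((γ : ℝ) + δ * σ) ^ n) (fun y σ hv => ?_)
      (hasPrim_pow γ δ hδ n)
    rw [pow_add, mul_div_cancel_left₀ _ (pow_ne_zero m hv)]

/-- **Every `M(y, v(σ))/v(σ)^m`, `M ∈ ℚ[X 0, X 1]`, has a primitive of the shape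
`Rn(y,σ)/v(σ)^k + a(y) log|v(σ)|`** (linearity in `M`; a monomial `c·y^p·v^j/v^m` is `c·y^p`
times `hasPrim_pow_div_pow`). [folklore] -/
theorem hasPrim_aeval_div_pow (γ δ : ℚ) (hδ : δ ≠ 0) (M : MvPolynomial (Fin 2) ℚ) (m : ℕ) :
    ∃ (Rn : MvPolynomial (Fin 2) ℚ) (k : ℕ) (a : Polynomial ℚ), ∀ y σ : ℝ,
      (γ : ℝ) + δ * σ ≠ 0 → HasDerivAt (fun σ' : ℝ => aeval ![y, σ'] Rn / ((γ : ℝ) + δ * σ') ^ k +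
        Polynomial.aeval y a * Real.log |(γ : ℝ) + δ * σ'|)
        (aeval ![y, (γ : ℝ) + δ * σ] M / ((γ : ℝ) + δ * σ) ^ m) σ := by
  induction M using MvPolynomial.induction_on' with
  | monomial j c =>
    refine hasPrim_congr γ δ (fun y σ hv => ?_)
      (hasPrim_mul γ δ (Polynomial.C c * Polynomial.X ^ (j 0)) (hasPrim_pow_div_pow γ δ hδ (j 1) m))
    rw [map_mul, map_pow, Polynomial.aeval_C, Polynomial.aeval_X, aeval_monomial,
      Finsupp.prod_pow, Fin.prod_univ_two, eq_ratCast, Matrix.cons_val_zero, Matrix.cons_val_one,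
      Matrix.cons_val_zero]
    ring
  | add p q hp hq =>
    refine hasPrim_congr γ δ (fun y σ hv => ?_) (hasPrim_add γ δ hp hq)
    rw [map_add, add_div]

/-! ### The integrand as `M(y, v(σ))/v(σ)^m` -/

/-- `σ = (v − γ)/δ`: the real evaluation of `S = δ⁻¹(X 1 − γ)` at `(y, v(σ))` is `σ`. [folklore] -/
theorem aeval_slope (γ δ : ℚ) (hδ : δ ≠ 0) (y σ : ℝ) :
    aeval ![y, (γ : ℝ) + δ * σ] (C δ⁻¹ * (X 1 - C γ) : MvPolynomial (Fin 2) ℚ) = σ := by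
  have hδ' : (δ : ℝ) ≠ 0 := by exact_mod_cast hδ
  simp only [map_mul, map_sub, aeval_C, aeval_X, eq_ratCast, Matrix.cons_val_one,
    Matrix.cons_val_zero, Rat.cast_inv]
  field_simp
  ring

/-- `u(σ) = ũ(v(σ))` with `ũ = u(δ⁻¹(X 1 − γ)) ∈ ℚ[X 0, X 1]`. [folklore] -/
theorem aeval_comp_slope (u : Polynomial ℚ) (γ δ : ℚ) (hδ : δ ≠ 0) (y σ : ℝ) :
    aeval ![y, (γ : ℝ) + δ * σ]
        (Polynomial.aeval (C δ⁻¹ * (X 1 - C γ) : MvPolynomial (Fin 2) ℚ) u) =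
      Polynomial.aeval σ u := by
  rw [← Polynomial.aeval_algHom_apply, aeval_slope γ δ hδ y σ]

/-- **The integrand is `M(y, v(σ))/v(σ)^m`.** For every `P ∈ ℚ[z₁, z₂]` there are
`M ∈ ℚ[X 0, X 1]` and `m ∈ ℕ` with `P((y − u(σ))/v(σ), σ)/v(σ) = M(y, v(σ))/v(σ)^m` wherever
`v(σ) ≠ 0` (induction on `P`). [folklore] -/
theorem exists_rep (u : Polynomial ℚ) (γ δ : ℚ) (hδ : δ ≠ 0) (P : MvPolynomial (Fin 2) ℚ) :
    ∃ (M : MvPolynomial (Fin 2) ℚ) (m : ℕ), ∀ y σ : ℝ, (γ : ℝ) + δ * σ ≠ 0 →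
      aeval ![(y - Polynomial.aeval σ u) / ((γ : ℝ) + δ * σ), σ] P / ((γ : ℝ) + δ * σ) =
        aeval ![y, (γ : ℝ) + δ * σ] M / ((γ : ℝ) + δ * σ) ^ m := by
  induction P using MvPolynomial.induction_on with
  | C c => exact ⟨C c, 1, fun y σ _ => by rw [aeval_C, aeval_C, pow_one]⟩
  | add p q hp hq =>
    obtain ⟨M₁, m₁, h₁⟩ := hp
    obtain ⟨M₂, m₂, h₂⟩ := hq
    refine ⟨M₁ * X 1 ^ m₂ + M₂ * X 1 ^ m₁, m₁ + m₂, fun y σ hv => ?_⟩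
    rw [map_add, add_div, h₁ y σ hv, h₂ y σ hv,
      div_add_div _ _ (pow_ne_zero _ hv) (pow_ne_zero _ hv), ← pow_add]
    simp only [map_add, map_mul, map_pow, aeval_X, Matrix.cons_val_one, Matrix.cons_val_zero]
    ring
  | mul_X p i hp =>
    obtain ⟨M, m, h⟩ := hp
    fin_cases i
    · refine ⟨M * (X 0 - Polynomial.aeval (C δ⁻¹ * (X 1 - C γ) : MvPolynomial (Fin 2) ℚ) u),
        m + 1, fun y σ hv => ?_⟩
      rw [map_mul, map_mul, map_sub, aeval_comp_slope u γ δ hδ y σ, mul_div_right_comm, h y σ hv,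
        pow_succ]
      simp only [aeval_X, Fin.zero_eta, Fin.isValue, Matrix.cons_val_zero]
      rw [div_mul_div_comm]
    · refine ⟨M * (C δ⁻¹ * (X 1 - C γ)), m, fun y σ hv => ?_⟩
      rw [map_mul, map_mul, aeval_slope γ δ hδ y σ, mul_div_right_comm, h y σ hv,
        mul_div_right_comm]
      simp

/-! ### The fundamental theorem of calculus on `[s, 1]` -/

/-- Fundamental theorem of calculus on `[s, 1]` for the `Ioo`-integral of a continuous
derivative. [folklore] -/
theorem integral_Ioo_eq_sub {F f : ℝ → ℝ} {s : ℝ} (hs : s ≤ 1)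
    (hderiv : ∀ x ∈ Icc s 1, HasDerivAt F (f x) x) (hcont : ContinuousOn f (Icc s 1)) :
    ∫ x in Ioo s 1, f x = F 1 - F s := by
  -- adapted from Theorems/InverseLandauTateFamilyKernelStubLinResidues.lean
  rw [← integral_Ioc_eq_integral_Ioo, ← intervalIntegral.integral_of_le hs]
  have h1 : uIcc s 1 = Icc s 1 := uIcc_of_le hs
  refine intervalIntegral.integral_eq_sub_of_hasDerivAt (fun x hx => hderiv x (h1 ▸ hx)) ?_
  exact (hcont.mono h1.le).intervalIntegrable

end GvPrimitive

/-- **Linear-slope graph pencils, step GV3a** (stub `stub_gvPrimitive` of the crux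
`TateFamilyKernel`, line `Sketch`): **the single-branch primitive is rational plus one logarithm.**
For `u ∈ ℚ[s]`, `γ, δ ∈ ℚ` with `δ ≠ 0` and `P ∈ ℚ[z₁, z₂]` there are `Rn ∈ ℚ[X 0, X 1]`, `k ∈ ℕ`
and `a ∈ ℚ[X]` such that, with `v(σ) = γ + δσ` and
`F(y, σ) = Rn(y, σ)/v(σ)^k + a(y)·log|v(σ)|`,

  `∫_{σ ∈ (s,1)} P((y − u(σ))/v(σ), σ)/v(σ) dσ = F(y, 1) − F(y, s)`

for all real `y` and all real `s ≤ 1` with `v ≠ 0` on `[s, 1]` (partial fractions in the linear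
form `v`, one logarithm from the residual power `v⁻¹`, then the fundamental theorem of calculus).
[folklore] -/
theorem stub_gvPrimitive (u : Polynomial ℚ) (γ δ : ℚ) (hδ : δ ≠ 0) (P : MvPolynomial (Fin 2) ℚ) :
    ∃ (Rn : MvPolynomial (Fin 2) ℚ) (k : ℕ) (a : Polynomial ℚ), ∀ y s : ℝ, s ≤ 1 →
      (∀ σ ∈ Icc s 1, (γ : ℝ) + δ * σ ≠ 0) →
      ∫ σ in Ioo s 1, aeval (![(y - Polynomial.aeval σ u) / (γ + δ * σ), σ] : Fin 2 → ℝ) P /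
          (γ + δ * σ) =
        (aeval (![y, 1] : Fin 2 → ℝ) Rn / (γ + δ) ^ k +
            Polynomial.aeval y a * Real.log |(γ : ℝ) + δ|) -
        (aeval (![y, s] : Fin 2 → ℝ) Rn / (γ + δ * s) ^ k +
            Polynomial.aeval y a * Real.log |(γ : ℝ) + δ * s|) := by
  obtain ⟨M, m, hM⟩ := GvPrimitive.exists_rep u γ δ hδ P
  obtain ⟨Rn, k, a, hF⟩ := GvPrimitive.hasPrim_aeval_div_pow γ δ hδ M m
  refine ⟨Rn, k, a, fun y s hs hv => ?_⟩
  have hcont : ContinuousOn (fun σ : ℝ =>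
      aeval ![y, (γ : ℝ) + δ * σ] M / ((γ : ℝ) + δ * σ) ^ m) (Icc s 1) :=
    ContinuousOn.div₀
      ((GpPolyIntegral.continuous_aeval_snd M y).comp
        (continuous_const.add (continuous_const.mul continuous_id))).continuousOn
      (by fun_prop) fun x hx => pow_ne_zero _ (hv x hx)
  have h := GvPrimitive.integral_Ioo_eq_sub hs
    (F := fun σ' : ℝ => aeval ![y, σ'] Rn / ((γ : ℝ) + δ * σ') ^ k +
      Polynomial.aeval y a * Real.log |(γ : ℝ) + δ * σ'|)
    (fun x hx => (hF y x (hv x hx)).congr_deriv (hM y x (hv x hx)).symm)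
    (hcont.congr fun x hx => hM y x (hv x hx))
  rw [h, mul_one]

end Summit.KontsevichZagierPeriods.InverseLandau.TateFamilyKernel.Descent
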